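import Literature.LinearAlgebra.RootSystem.AffineWeylGroupLength
import HarnessLib

/-!
# The group `Ω = Stab_{Ŵ_a}(A∘)`: abelian, permutes the walls `S_a` by conjugation (Iwahori–Matsumoto 1965 §1.7; Bourbaki VI §2 no. 3)

N. Iwahori, H. Matsumoto, *On some Bruhat decomposition …*, Publ. Math. IHÉS 25 (1965) [IwahoriMatsumoto1965] (held
`paper:doi-10-1007-bf02684396`, pp. 247–248), §1.7: «Let us define a subgroup `Ω` of `DW` by `Ω = {σ ∈ DW; σD∘ = D∘}` … `DW = Ω·(D'W)`,
`Ω ∩ D'W = {1}`. Hence we have `Ω ≅ DW ∕ D'W ≅ D ∕ D' ≅ P ∕ P_r`. Thus `Ω` is a finite abelian group … `λ(ρσρ') = λ(σ)` for any `σ ∈ DW` and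
`ρ, ρ' ∈ Ω` … Now let us give an explicit description of `Ω`. Let `σ = T(d)w ∈ Ω` where `d ∈ D`, `w ∈ W`. Assume `σ ≠ 1`. Then `d ≠ 0` since
`Ω ∩ W ⊂ Ω ∩ D'W = {1}` … Note that `w` is uniquely determined by `d`.»  J. E. Humphreys, *Reflection Groups and Coxeter Groups* (1990)
[Humphreys1990], §4.5 (p. 93): «`Ω ≅ Ŵ_a ∕ W_a ≅ L̂ ∕ L`».

THIS FILE (lane `lit-hodgefound`, prover seat p40, generation 44, row g44-#11; THEOREMS ONLY — no definition, instance, notation or named fact;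
net debt 0), conventions of rows g44-#1 ∕ #6–#10; `Ω` is spoken of in element language («`o ∈ Ŵ_a` with `o · A∘ = A∘`»), `S_a` is the set
`{s_{α_j} (j ∈ Δ), s_{α_η,1}}` of rows g44-#3 ∕ #7.

* §1 `Ω` IS A GROUP: `mul_mem_stabilizer`, `inv_mem_stabilizer` (closure of `{o ∈ Ŵ_a | oA∘ = A∘}` under products and inverses).
* §2 ★★★ `stabilizer_mul_comm` — «`Ω` IS … ABELIAN»: two elements of `Ω` commute (their translation parts add modulo `Q`, and an element of `Ω`
  is determined by its translation part modulo `Q`, row g44-#8). ★ `stabilizer_eq_one_of_weightLattice_le` (`P(Φ) = Q ⟹ Ω = 1`).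
* §3 ★★★ `conj_mem_walls_of_image_eq` — «`Ω` PERMUTES THE WALLS OF `A∘`»: for `o ∈ Ω` and `s ∈ S_a`, `o s o⁻¹ ∈ S_a` (the alcove `os A∘` is
  adjacent to `A∘` — separating count `2`, rows g44-#6 ∕ #10 — so one wall `s'` brings it back, and `s' · oso⁻¹ ∈ W_a` fixes `A∘`, hence is `1`
  by simple transitivity, row g44-#8); ★★ `sum_abs_wallData_eq_two` (the alcoves `sA∘`, `s ∈ S_a`, are exactly at count `2`), and
  `walls_conj_bijective`-type statement `exists_unique_conj_eq` (conjugation by `o` is a bijection of `S_a`).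

## References

* [IwahoriMatsumoto1965] N. Iwahori, H. Matsumoto, Publ. Math. IHÉS 25 (1965), §1.7 (pp. 247–248).
* [Humphreys1990] J. E. Humphreys, *Reflection Groups and Coxeter Groups*, CUP (1990), §4.5 closing paragraph (p. 93), §4.4.
* [Bourbaki2002LieGroups46] N. Bourbaki, *Lie Groups and Lie Algebras, Chapters 4–6*, Ch. VI §2 no. 3 (cite-only).
-/

noncomputable section

open Module Set Function

namespace Literature.LinearAlgebra.RootSystem

namespace Base

variable {ι K M N : Type*} [Field K] [LinearOrder K] [IsStrictOrderedRing K] [AddCommGroup M] [Module K M]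
  [AddCommGroup N] [Module K N] [Fintype ι] [DecidableEq ι]
  {P : RootPairing ι K M N} [CharZero K] [P.IsCrystallographic] [P.IsReduced] (b : P.Base)

omit [LinearOrder K] [IsStrictOrderedRing K] [Fintype ι] [DecidableEq ι] [CharZero K] [P.IsCrystallographic] [P.IsReduced] in
/-- `(a c) · S = a · (c · S)`. [folklore] -/
private theorem image_mul' (a c : M ≃ᵃ[K] M) (S : Set M) : ⇑(a * c) '' S = a '' (c '' S) := by
  rw [AffineEquiv.coe_mul, image_comp]

omit [LinearOrder K] [IsStrictOrderedRing K] [Fintype ι] [DecidableEq ι] [CharZero K] [P.IsCrystallographic] [P.IsReduced] in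
/-- `a⁻¹ · (a · S) = S`. [folklore] -/
private theorem inv_image_image' (a : M ≃ᵃ[K] M) (S : Set M) : ⇑a⁻¹ '' (a '' S) = S := by
  rw [← image_mul', inv_mul_cancel, AffineEquiv.coe_one, image_id]

/-! ## §1 `Ω` is closed under products and inverses -/

section Group

omit [IsStrictOrderedRing K] [Fintype ι] [DecidableEq ι] [P.IsCrystallographic] [P.IsReduced] in
/-- `Ω` is closed under products. [cite: IwahoriMatsumoto1965, §1.7 ("a subgroup Ω of DW by Ω = {σ ∈ DW; σD∘ = D∘}")] -/
theorem mul_mem_stabilizer {o o' : M ≃ᵃ[K] M} (ho : o ∈ extendedAffineWeylGroup P) (ho' : o' ∈ extendedAffineWeylGroup P)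
    (hoA : o '' {x : M | ∀ i, b.IsPos i → 0 < P.coroot' i x ∧ P.coroot' i x < 1} =
      {x : M | ∀ i, b.IsPos i → 0 < P.coroot' i x ∧ P.coroot' i x < 1})
    (ho'A : o' '' {x : M | ∀ i, b.IsPos i → 0 < P.coroot' i x ∧ P.coroot' i x < 1} =
      {x : M | ∀ i, b.IsPos i → 0 < P.coroot' i x ∧ P.coroot' i x < 1}) :
    o * o' ∈ extendedAffineWeylGroup P ∧
      ⇑(o * o') '' {x : M | ∀ i, b.IsPos i → 0 < P.coroot' i x ∧ P.coroot' i x < 1} =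
        {x : M | ∀ i, b.IsPos i → 0 < P.coroot' i x ∧ P.coroot' i x < 1} :=
  ⟨mul_mem ho ho', by rw [image_mul', ho'A, hoA]⟩

omit [IsStrictOrderedRing K] [Fintype ι] [DecidableEq ι] [P.IsCrystallographic] [P.IsReduced] in
/-- `Ω` is closed under inverses. [cite: IwahoriMatsumoto1965, §1.7 ("a subgroup Ω of DW")] -/
theorem inv_mem_stabilizer {o : M ≃ᵃ[K] M} (ho : o ∈ extendedAffineWeylGroup P)
    (hoA : o '' {x : M | ∀ i, b.IsPos i → 0 < P.coroot' i x ∧ P.coroot' i x < 1} =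
      {x : M | ∀ i, b.IsPos i → 0 < P.coroot' i x ∧ P.coroot' i x < 1}) :
    o⁻¹ ∈ extendedAffineWeylGroup P ∧
      ⇑o⁻¹ '' {x : M | ∀ i, b.IsPos i → 0 < P.coroot' i x ∧ P.coroot' i x < 1} =
        {x : M | ∀ i, b.IsPos i → 0 < P.coroot' i x ∧ P.coroot' i x < 1} := by
  refine ⟨inv_mem ho, ?_⟩
  nth_rw 1 [← hoA]
  rw [inv_image_image']

end Group

/-! ## §2 `Ω` is abelian -/

section Abelian

/-- ★★★ **«THUS `Ω` IS A FINITE ABELIAN GROUP»** — the abelian part: two elements of `Ŵ_a` fixing `A∘` commute. (Both `oo'` and `o'o` fix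
`A∘` and have translation parts `≡ o(0) + o'(0) (mod Q)` (row g44-#4); an element of `Ω` is determined by its translation part modulo `Q`,
row g44-#8.) [cite: IwahoriMatsumoto1965, §1.7 ("Ω ≅ DW/D'W ≅ D/D' ≅ P/P_r. Thus Ω is a finite abelian group")] [cite: Humphreys1990, §4.5 ("Ω ≅ Ŵ_a/W_a ≅ L̂/L")] -/
theorem stabilizer_mul_comm [Nonempty ι] {η : ι}
    (hη : ∀ k, P.coroot η - P.coroot k ∈ AddSubmonoid.closure (P.coroot '' (b.support : Set ι))) {o o' : M ≃ᵃ[K] M}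
    (ho : o ∈ extendedAffineWeylGroup P) (ho' : o' ∈ extendedAffineWeylGroup P)
    (hoA : o '' {x : M | ∀ i, b.IsPos i → 0 < P.coroot' i x ∧ P.coroot' i x < 1} =
      {x : M | ∀ i, b.IsPos i → 0 < P.coroot' i x ∧ P.coroot' i x < 1})
    (ho'A : o' '' {x : M | ∀ i, b.IsPos i → 0 < P.coroot' i x ∧ P.coroot' i x < 1} =
      {x : M | ∀ i, b.IsPos i → 0 < P.coroot' i x ∧ P.coroot' i x < 1}) :
    o * o' = o' * o := by
  obtain ⟨h1, h1A⟩ := mul_mem_stabilizer b ho ho' hoA ho'A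
  obtain ⟨h2, h2A⟩ := mul_mem_stabilizer b ho' ho ho'A hoA
  refine eq_of_apply_zero_sub_apply_zero_mem_rootSpan b hη h1 h2 h1A h2A ?_
  have h3 := mul_apply_zero_sub_mem_rootSpan P ho ho'
  have h4 := mul_apply_zero_sub_mem_rootSpan P ho' ho
  have h5 := sub_mem h3 h4
  convert h5 using 1
  abel

/-- ★ **IF `P(Φ) = Q` THEN `Ω = 1`** (every element of `Ŵ_a = W_a` fixing `A∘` is trivial, row g44-#8). [cite: Humphreys1990, §4.5 ("Ω ≅ Ŵ_a/W_a ≅ L̂/L")] [cite: IwahoriMatsumoto1965, §1.7] -/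
theorem stabilizer_eq_one_of_weightLattice_le [Nonempty ι] {η : ι}
    (hη : ∀ k, P.coroot η - P.coroot k ∈ AddSubmonoid.closure (P.coroot '' (b.support : Set ι)))
    (hPQ : weightLattice P ≤ (P.rootSpan ℤ).toAddSubgroup) {o : M ≃ᵃ[K] M} (ho : o ∈ extendedAffineWeylGroup P)
    (hoA : o '' {x : M | ∀ i, b.IsPos i → 0 < P.coroot' i x ∧ P.coroot' i x < 1} =
      {x : M | ∀ i, b.IsPos i → 0 < P.coroot' i x ∧ P.coroot' i x < 1}) : o = 1 := by
  have hoW : o ∈ affineWeylGroup P :=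
    (mem_affineWeylGroup_iff_apply_zero_mem_rootSpan P ho).mpr
      ((Submodule.mem_toAddSubgroup _).mp (hPQ (apply_zero_mem_weightLattice P ho)))
  exact eq_one_of_mem_affineWeylGroup_of_image_eq b hη hoW hoA

end Abelian

/-! ## §3 `Ω` permutes the walls `S_a` of `A∘` -/

section Walls

/-- ★★ **THE ALCOVES `sA∘`, `s ∈ S_a`, ARE ADJACENT TO `A∘`**: if `s · A∘ = alcove k` for `s ∈ S_a` then `Σ_α |k_α - k∘_α| = 2`
(«`n(s) = 1` if `s ∈ S_a`»). [cite: Humphreys1990, §4.4 ("n(s) = 1 if s ∈ S_a, which amounts to showing that 𝓛(s) = {H_s}")] -/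
theorem sum_abs_wallData_eq_two [Nonempty ι] [DecidablePred b.IsPos] {η : ι}
    (hη : ∀ k, P.coroot η - P.coroot k ∈ AddSubmonoid.closure (P.coroot '' (b.support : Set ι))) {s : M ≃ᵃ[K] M}
    (hs : s ∈ (fun j ↦ affineHom P (RootPairing.Equiv.reflection P j)) '' (b.support : Set ι) ∪ {affineReflection P η 1})
    {k : ι → ℤ} (hk : s '' {x : M | ∀ i, b.IsPos i → 0 < P.coroot' i x ∧ P.coroot' i x < 1} = alcove P k) :
    ∑ i, |k i - (if b.IsPos i then (0 : ℤ) else -1)| = 2 := by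
  have h2 := sum_abs_sub_le_two_mul_length b hη [s] (fun t ht ↦ by rwa [List.mem_singleton.mp ht])
    (by rwa [List.prod_singleton])
  rw [List.length_singleton, Nat.cast_one, mul_one] at h2
  -- the count is not `0` (else `sA∘ = A∘`, `s = 1`, but `s` moves `A∘`) and it is even: it is `2`
  obtain ⟨L, hL, hLw, hlen⟩ := exists_list_prod_eq_of_image_eq b hη (mem_affineWeylGroup_of_mem_walls b η hs) hk
  have hne : ∑ i, |k i - (if b.IsPos i then (0 : ℤ) else -1)| ≠ 0 := by
    intro h0
    rw [h0, mul_eq_zero, or_iff_right (two_ne_zero), Nat.cast_eq_zero, List.length_eq_zero_iff] at hlen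
    rw [hlen, List.prod_nil] at hLw
    -- `s = 1` is absurd: `s` moves the point of `A∘` off `A∘` (row g44-#5: `sA∘` lies across `H_s`)
    obtain ⟨x₀, hx₀⟩ : {x : M | ∀ i, b.IsPos i → 0 < P.coroot' i x ∧ P.coroot' i x < 1}.Nonempty :=
      ⟨_, smul_sum_filter_isPos_mem_fundamentalAlcove b hη⟩
    have hsx : s x₀ ∈ s '' {x : M | ∀ i, b.IsPos i → 0 < P.coroot' i x ∧ P.coroot' i x < 1} := mem_image_of_mem _ hx₀
    rcases hs with ⟨j, hj, rfl⟩ | hs'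
    · have h := (coroot'_mem_Ioo_of_mem_image_reflection b hj hsx).2
      rw [← hLw, AffineEquiv.coe_one, id_eq] at h
      exact (lt_asymm h) (hx₀ j (RootPairing.Base.isPos_of_mem_support hj)).1
    · rw [mem_singleton_iff.mp hs'] at hsx hLw
      have h := (coroot'_mem_Ioo_of_mem_image_affineReflection_one b hη hsx).1
      rw [← hLw, AffineEquiv.coe_one, id_eq] at h
      have hηpos : b.IsPos η := (flip_isPos_iff b η).mp (isPos_of_highestRoot (P := P.flip) b.flip (θ := η)
        (by simpa only [RootPairing.flip_root, RootPairing.Base.flip_support] using hη))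
      exact (lt_asymm h) (hx₀ η hηpos).2
  omega

/-- ★★★ **`Ω` PERMUTES THE WALLS OF `A∘` BY CONJUGATION**: for `o ∈ Ŵ_a` with `o · A∘ = A∘` and `s ∈ S_a = {s_{α_j} (j ∈ Δ), s_{α_η,1}}`,
`o s o⁻¹ ∈ S_a`. (The alcove `(oso⁻¹)A∘ = osA∘` is at separating count `2` from `A∘ = oA∘` — the count is `Ŵ_a`-invariant, row g44-#6 —
so a single wall `s' ∈ S_a` maps it back to `A∘` (row g44-#10); then `s'·oso⁻¹ ∈ W_a` fixes `A∘` and is `1` by simple transitivity,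
row g44-#8: `oso⁻¹ = s'`.) [cite: IwahoriMatsumoto1965, §1.7 ("λ(ρσρ') = λ(σ) for any σ ∈ DW and ρ, ρ' ∈ Ω")] [cite: Bourbaki2002LieGroups46, Ch. VI §2 no. 3] [cite: Humphreys1990, §4.5 ("If Ω is the subgroup of Ŵ_a stabilizing A∘")] -/
theorem conj_mem_walls_of_image_eq [Nonempty ι] {η : ι}
    (hη : ∀ k, P.coroot η - P.coroot k ∈ AddSubmonoid.closure (P.coroot '' (b.support : Set ι))) {o : M ≃ᵃ[K] M}
    (ho : o ∈ extendedAffineWeylGroup P)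
    (hoA : o '' {x : M | ∀ i, b.IsPos i → 0 < P.coroot' i x ∧ P.coroot' i x < 1} =
      {x : M | ∀ i, b.IsPos i → 0 < P.coroot' i x ∧ P.coroot' i x < 1}) {s : M ≃ᵃ[K] M}
    (hs : s ∈ (fun j ↦ affineHom P (RootPairing.Equiv.reflection P j)) '' (b.support : Set ι) ∪ {affineReflection P η 1}) :
    o * s * o⁻¹ ∈ (fun j ↦ affineHom P (RootPairing.Equiv.reflection P j)) '' (b.support : Set ι) ∪ {affineReflection P η 1} := by
  classical
  have hsW : s ∈ affineWeylGroup P := mem_affineWeylGroup_of_mem_walls b η hs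
  -- the data of `sA∘` and of `osA∘ = (oso⁻¹)A∘`
  obtain ⟨ks, hks⟩ := exists_image_eq_alcove_of_mem_affineWeylGroup hsW (fun i ↦ if b.IsPos i then (0 : ℤ) else -1)
  rw [← fundamentalAlcove_eq_alcove b] at hks
  have h2 : ∑ i, |ks i - (if b.IsPos i then (0 : ℤ) else -1)| = 2 := sum_abs_wallData_eq_two b hη hs hks
  obtain ⟨v, hv, g, -, rfl⟩ := exists_of_mem_extendedAffineWeylGroup P ho
  choose m hm using hv
  have hok₀ : (fun i ↦ (if b.IsPos (g⁻¹ • i) then (0 : ℤ) else -1) + m i) = fun i ↦ if b.IsPos i then (0 : ℤ) else -1 := by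
    -- `o · A∘ = A∘`: the relabelled reference datum is the reference datum
    obtain ⟨x₀, hx₀⟩ : {x : M | ∀ i, b.IsPos i → 0 < P.coroot' i x ∧ P.coroot' i x < 1}.Nonempty :=
      ⟨_, smul_sum_filter_isPos_mem_fundamentalAlcove b hη⟩
    have himage := image_constVAdd_mul_affineHom_alcove (P := P) (fun i ↦ if b.IsPos i then (0 : ℤ) else -1) g hm
    rw [← fundamentalAlcove_eq_alcove b, hoA, fundamentalAlcove_eq_alcove b] at himage
    have hx₁ : x₀ ∈ alcove P (fun i ↦ if b.IsPos i then (0 : ℤ) else -1) := by rwa [← fundamentalAlcove_eq_alcove b]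
    exact (eq_of_mem_alcove_of_mem_alcove (himage ▸ hx₁) hx₁)
  have hconj : ⇑(AffineEquiv.constVAdd K M v * affineHom P g * s * (AffineEquiv.constVAdd K M v * affineHom P g)⁻¹) ''
      {x : M | ∀ i, b.IsPos i → 0 < P.coroot' i x ∧ P.coroot' i x < 1} = alcove P (fun i ↦ ks (g⁻¹ • i) + m i) := by
    rw [image_mul', image_mul']
    nth_rw 1 [← hoA]
    rw [inv_image_image', hks, image_constVAdd_mul_affineHom_alcove ks g hm]
  have hcount : ∑ i, |(ks (g⁻¹ • i) + m i) - (if b.IsPos i then (0 : ℤ) else -1)| = 2 := by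
    have h := sum_abs_sub_smul_data ks (fun i ↦ if b.IsPos i then (0 : ℤ) else -1) g m
    have hok₀' : ∀ i, (if b.IsPos (g⁻¹ • i) then (0 : ℤ) else -1) + m i = (if b.IsPos i then (0 : ℤ) else -1) :=
      fun i ↦ congrFun hok₀ i
    simp only [hok₀'] at h
    rw [h, h2]
  -- one wall brings `osA∘` back to `A∘`
  have hne : (alcove P (fun i ↦ ks (g⁻¹ • i) + m i)).Nonempty := by
    obtain ⟨x₀, hx₀⟩ : {x : M | ∀ i, b.IsPos i → 0 < P.coroot' i x ∧ P.coroot' i x < 1}.Nonempty :=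
      ⟨_, smul_sum_filter_isPos_mem_fundamentalAlcove b hη⟩
    exact ⟨_, hconj ▸ mem_image_of_mem _ hx₀⟩
  obtain ⟨L, hL, hLA, hlen⟩ := exists_list_prod_image_alcove_eq b hη hne
  rw [hcount] at hlen
  obtain ⟨s', hLs'⟩ : ∃ s', L = [s'] := List.length_eq_one_iff.mp (by exact_mod_cast (by omega : (L.length : ℤ) = 1))
  subst hLs'
  have hs' : s' ∈ (fun j ↦ affineHom P (RootPairing.Equiv.reflection P j)) '' (b.support : Set ι) ∪ {affineReflection P η 1} :=
    hL s' (List.mem_singleton_self s')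
  rw [List.prod_singleton, ← hconj, ← image_mul'] at hLA
  -- `s' · (oso⁻¹) ∈ W_a` fixes `A∘`: it is `1`
  have hconjW : AffineEquiv.constVAdd K M v * affineHom P g * s * (AffineEquiv.constVAdd K M v * affineHom P g)⁻¹ ∈
      affineWeylGroup P :=
    ((Subgroup.mem_normalizer_iff).mp (extendedAffineWeylGroup_le_normalizer_affineWeylGroup P ho) s).mp hsW
  have h1 := eq_one_of_mem_affineWeylGroup_of_image_eq b hη (mul_mem (mem_affineWeylGroup_of_mem_walls b η hs') hconjW) hLA
  rw [mul_eq_one_iff_inv_eq, inv_eq_self_of_mem_walls b η hs'] at h1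
  rw [← h1]
  exact hs'

/-- ★★ Conjugation by `o ∈ Ω` is a BIJECTION of `S_a` onto itself: every wall is `o s o⁻¹` for exactly one wall `s`.
[cite: IwahoriMatsumoto1965, §1.7] [cite: Bourbaki2002LieGroups46, Ch. VI §2 no. 3] -/
theorem existsUnique_conj_eq [Nonempty ι] {η : ι}
    (hη : ∀ k, P.coroot η - P.coroot k ∈ AddSubmonoid.closure (P.coroot '' (b.support : Set ι))) {o : M ≃ᵃ[K] M}
    (ho : o ∈ extendedAffineWeylGroup P)
    (hoA : o '' {x : M | ∀ i, b.IsPos i → 0 < P.coroot' i x ∧ P.coroot' i x < 1} =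
      {x : M | ∀ i, b.IsPos i → 0 < P.coroot' i x ∧ P.coroot' i x < 1}) {s' : M ≃ᵃ[K] M}
    (hs' : s' ∈ (fun j ↦ affineHom P (RootPairing.Equiv.reflection P j)) '' (b.support : Set ι) ∪ {affineReflection P η 1}) :
    ∃! s, s ∈ (fun j ↦ affineHom P (RootPairing.Equiv.reflection P j)) '' (b.support : Set ι) ∪ {affineReflection P η 1} ∧
      o * s * o⁻¹ = s' := by
  obtain ⟨hoi, hoiA⟩ := inv_mem_stabilizer b ho hoA
  refine ⟨o⁻¹ * s' * o⁻¹⁻¹, ⟨conj_mem_walls_of_image_eq b hη hoi hoiA hs', by group⟩, fun s ⟨_, hs⟩ ↦ ?_⟩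
  rw [← hs]
  group

end Walls

end Base

end Literature.LinearAlgebra.RootSystem
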